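import Summits.BirchSwinnertonDyer.BirchSwinnertonDyer.Theorems.Rank1ResidualJetCoreVertexWalkRow
import Summits.BirchSwinnertonDyer.BirchSwinnertonDyer.Theorems.PrintX9JetchevX9CebotarevShift
import HarnessLib

/-!
# Route `PrintX9`, crux J = `HeegnerDivisibilityX9` (item 20392), stub `stub_jetchevX9` — toward the X9 reading
# `CoreVertexExistenceX9`: step 2, [J] Prop. 6.4 ON THE ROW OBJECTS, FULL form, on an X9 Heegner frame (`ClassX9 W p`,
# `K` Heegner for `N_E` with `p` SPLIT) — the kernel walk `JET.Section6.exists_coreVertex_adm` instantiated exactly as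
# bsd-jet pv-1 g8's `JET.exists_coreVertex_of_orderedFamilies`, with the UNCONDITIONAL X9 Lemma 6.1 (with shift)

Cell `bsd-print-x9` (print tier, key `x9`), prover seat p4; `--supports stmt-BirchSwinnertonDyer-20392`,
helper; THEOREMS ONLY (block-1 inputs `hdisj`, `hPT`, `hκt`, `hordκ`, `h47` are hypothesis-shaped binders discharged in
the sequel); nothing booked, no item closed, BSD is not proved by any of this.

WHAT. `exists_coreVertex_of_orderedFamilies_of_classX9` = bsd-potss k9-c4 g10's
`JetchevIrreducibleCoreVertex.exists_coreVertex_of_orderedFamilies_of_irreducible` (itself pv-1 g8's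
`JET.exists_coreVertex_of_orderedFamilies` with the frame binder `ρ̄_{E,p}` onto ↦ {¬CM, Heegner, `E[p]` irreducible,
`p ∣ N_E`}) with the row binders ↦ {`ClassX9 W p`, Heegner for `N_E`, `p` split in `K`} — their one use, the decoupled
Lemma 6.1 with shift, is now `JET.Split.exists_kolyvaginPrime_addOrderOf_localization_eq_shift_of_classX9_of_heegner`
(`PrintX9JetchevX9CebotarevShift`, UNCONDITIONAL over ty2's file F); the pool of fresh primes and the `ℓ ≠ 2` guard of
`h47` unchanged; everything else byte-identical. CONCLUSION: an admissible multiple `s` of `c` which is a CORE VERTEX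
with `m(s) ≤ m(c)`.
References (locators only): [cite: Jetchev2008, Prop. 6.4 (p. 824) = print Prop. 5.3 (p. 823); §3.1, §4.2–4.3, Prop. 4.7,
Thm. 5.1, Lemma 5.2, Lemma 6.1, §5.2, Rem. 6.2] [cite: McCallumLMS1991, §3 Cor. 3.2, §4 Prop. 4.4] [cite: WZhang2014, Notations (xii)].
-/

set_option autoImplicit false

noncomputable section

open scoped Classical NumberField

namespace Summit.BirchSwinnertonDyer.Rank1Residual.JET.Split

open WeierstrassCurve IsDedekindDomain NumberField Literature.NumberTheory.EllipticCurves
  Literature.NumberTheory.EllipticCurves.ModularForms Literature.NumberTheory.EllipticCurves.Jetchev2008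
  Literature.NumberTheory.GaloisRepresentations
  Literature.NumberTheory.GaloisRepresentations.DiscreteGaloisModule
  Summit.BirchSwinnertonDyer.Rank1Residual Summit.BirchSwinnertonDyer.Rank1Residual.X11b
  Summit.BirchSwinnertonDyer.Rank1Residual.X11b.Three.Koly
  Summit.BirchSwinnertonDyer.Rank1Residual.JET
  Summit.BirchSwinnertonDyer.BirchSwinnertonDyer.Theorems
  Literature.NumberTheory.EllipticCurves.Rank1Residual

/-- **[J] Prop. 6.4 on the row objects, FULL form, ORDERED and BASED input shapes — X9 ROW: an admissible multiple of
`c` is a CORE VERTEX with `m(c') ≤ m(c)`.** bsd-jet pv-1 g8's `JET.exists_coreVertex_of_orderedFamilies` VERBATIM except: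
the frame binder `ρ̄_{E,p}` onto is replaced by {`ClassX9 W p`, Heegner hypothesis for `N_E`, `p` split in `K`} (used only in
the walk's Lemma 6.1 step, now `exists_kolyvaginPrime_addOrderOf_localization_eq_shift_of_classX9_of_heegner`);
the pool of fresh Kolyvagin primes EXCLUDES `ℓ = 2` (possible only when `p = 3`; Čebotarev supplies primes above any bound),
so the Prop. 4.7 input `h47` is asked only at primes `ℓ ≠ 2` — the guard of k8t-c4 g11's primed (B)-only reading `h47P2`
of [McC] Prop. 4.4 (a theorem modulo Gross 1991 Prop. 3.7 (2), p541604). Frame, structures, block-1 inputs (`hdisj`, `hPT`,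
`hκt`, `hordκ`, `h47`) and CONCLUSION otherwise byte-identical: `∃ s`, `c ∣ s`, every prime factor of `s` divides `c` or
has index `≥ k + m(c)`, `(H_{𝓕(s)})^{−ε(s)} = ⊥`, `(H_{𝓕(s)})^{ε(s)}` cyclic of order `p^k`, `m(s) ≤ m(c)`. PROOF:
`JET.Section6.exists_coreVertex_adm` with pv-1's dictionary. [cite: Jetchev2008, Prop. 6.4 (p. 824), §5.2 (p. 821), Rem. 6.2]
[cite: McCallumLMS1991, §3 Cor. 3.2, §4 Prop. 4.4] -/
theorem exists_coreVertex_of_orderedFamilies_of_classX9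
    (W : WeierstrassCurve ℚ) [W.IsElliptic] [W.IsGloballyMinimal] [NeZero (W.conductorNorm ℤ)]
    (K : Type) [Field K] [NumberField K] (hK : IsImaginaryQuadratic K)
    (hH : SatisfiesHeegnerHypothesis (W.conductorNorm ℤ) K)
    (p : ℕ) [Fact p.Prime] (hX9 : ClassX9 W p) (hHp : SatisfiesHeegnerHypothesis p K)
    (Dt : ModularParametrizationData W (W.conductorNorm ℤ)) (β : ℤ) (ι : K →+* ℂ)
    (τ : K ≃ₐ[ℚ] K) (hτ : τ ≠ 1) (k : ℕ) (hk : 1 ≤ k)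
    (𝒯 : SelmerStructure ((W.baseChange K).torsionGaloisModule ((p ^ k : ℕ) : ℤ)))
    (D : ∀ s : {m : ℕ // Squarefree m ∧ ∀ q ∈ m.primeFactors,
        Zhang2014.IsKolyvaginPrime (W.conductorNorm ℤ) W K p q ∧ k ≤ Zhang2014.kolyvaginIndex W p q},
      KolyvaginHeegnerData Dt β ι s.1)
    (eb : ℕ → Bool) (heb : ∀ (m ℓ : ℕ), ℓ.Prime → ¬ ℓ ∣ m → eb (m * ℓ) = !eb m)
    (c : ℕ) (hc : Squarefree c ∧ ∀ q ∈ c.primeFactors,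
      Zhang2014.IsKolyvaginPrime (W.conductorNorm ℤ) W K p q ∧ k ≤ Zhang2014.kolyvaginIndex W p q)
    (h0 : (if divOrd (D ⟨c, hc⟩) p < Zhang2014.levelIndex W p c then divOrd (D ⟨c, hc⟩) p
      else (⊤ : ℕ∞)) < (k : ℕ∞))
    (hMc : (k : ℕ∞) + (if divOrd (D ⟨c, hc⟩) p < Zhang2014.levelIndex W p c then divOrd (D ⟨c, hc⟩) p
      else ⊤) ≤ Zhang2014.levelIndex W p c)
    (hdisj : ∀ (ℓ : ℕ), Zhang2014.IsKolyvaginPrime (W.conductorNorm ℤ) W K p ℓ →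
      k ≤ Zhang2014.kolyvaginIndex W p ℓ → ¬ ℓ ∣ c → ∀ v : HeightOneSpectrum (𝓞 K), (ℓ : 𝓞 K) ∈ v.asIdeal →
      Disjoint ((W.baseChange K).kummerSelmerStructure ((p ^ k : ℕ) : ℤ) (Sum.inr v)) (𝒯 (Sum.inr v)))
    (hPT : ∀ (s : {m : ℕ // Squarefree m ∧ ∀ q ∈ m.primeFactors,
        Zhang2014.IsKolyvaginPrime (W.conductorNorm ℤ) W K p q ∧ k ≤ Zhang2014.kolyvaginIndex W p q})
      (ℓ : ℕ), Zhang2014.IsKolyvaginPrime (W.conductorNorm ℤ) W K p ℓ →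
      k ≤ Zhang2014.kolyvaginIndex W p ℓ → ¬ ℓ ∣ s.1 → (∀ q ∈ s.1.primeFactors, q < ℓ) → c ∣ s.1 →
      ∀ v : HeightOneSpectrum (𝓞 K), (ℓ : 𝓞 K) ∈ v.asIdeal → ∀ b : Bool,
      Nat.card ((signPart W K τ ((p ^ k : ℕ) : ℤ) (if b then 1 else -1)
          ((selmerF W ((p ^ k : ℕ) : ℤ) 𝒯 (placesDividing K s.1)).relaxedAt {v}).selmerGroup).map
        (galoisCohomology.localization ((W.baseChange K).torsionGaloisModule ((p ^ k : ℕ) : ℤ))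
          (Sum.inr v) 1)) = p ^ k)
    (hκt : ∀ s, c ∣ s.1 →
      (if divOrd (D s) p < Zhang2014.levelIndex W p s.1 then divOrd (D s) p else (⊤ : ℕ∞)) +
        (k : ℕ∞) ≤ Zhang2014.levelIndex W p s.1 →
      ∃ x : galoisCohomology ((W.baseChange K).torsionGaloisModule ((p ^ k : ℕ) : ℤ)) 1,
        x ∈ signPart W K τ ((p ^ k : ℕ) : ℤ) (if eb s.1 then 1 else -1)
          (selmerF W ((p ^ k : ℕ) : ℤ) 𝒯 (placesDividing K s.1)).selmerGroup ∧
        addOrderOf x = p ^ k ∧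
        ((D s).kolyvaginClass (Fact.out : p.Prime) k :
            galoisCohomology ((W.baseChange K).torsionGaloisModule ((p ^ k : ℕ) : ℤ)) 1) =
          p ^ (if divOrd (D s) p < Zhang2014.levelIndex W p s.1 then divOrd (D s) p
            else (⊤ : ℕ∞)).toNat • x)
    (hordκ : ∀ s (j : ℕ), j < k →
      p ^ (k - j) ∣ addOrderOf ((D s).kolyvaginClass (Fact.out : p.Prime) k :
        galoisCohomology ((W.baseChange K).torsionGaloisModule ((p ^ k : ℕ) : ℤ)) 1) →
      divOrd (D s) p ≤ (j : ℕ∞))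
    (h47 : ∀ (s s' : {m : ℕ // Squarefree m ∧ ∀ q ∈ m.primeFactors,
        Zhang2014.IsKolyvaginPrime (W.conductorNorm ℤ) W K p q ∧ k ≤ Zhang2014.kolyvaginIndex W p q}) (ℓ : ℕ),
      ℓ.Prime → ℓ ≠ 2 → ¬ ℓ ∣ s.1 → s'.1 = s.1 * ℓ → (∀ q ∈ s.1.primeFactors, q < ℓ) → c ∣ s.1 →
      ∀ v : HeightOneSpectrum (𝓞 K), (ℓ : 𝓞 K) ∈ v.asIdeal →
      addOrderOf (galoisCohomology.localization ((W.baseChange K).torsionGaloisModule ((p ^ k : ℕ) : ℤ))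
          (Sum.inr v) 1 ((D s').kolyvaginClass (Fact.out : p.Prime) k)) =
        addOrderOf (galoisCohomology.localization ((W.baseChange K).torsionGaloisModule ((p ^ k : ℕ) : ℤ))
          (Sum.inr v) 1 ((D s).kolyvaginClass (Fact.out : p.Prime) k))) :
    ∃ s : {m : ℕ // Squarefree m ∧ ∀ q ∈ m.primeFactors,
        Zhang2014.IsKolyvaginPrime (W.conductorNorm ℤ) W K p q ∧ k ≤ Zhang2014.kolyvaginIndex W p q},
      c ∣ s.1 ∧
      (∀ q ∈ s.1.primeFactors, q ∈ c.primeFactors ∨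
        ((k : ℕ∞) + (if divOrd (D ⟨c, hc⟩) p < Zhang2014.levelIndex W p c then divOrd (D ⟨c, hc⟩) p
          else ⊤) ≤ (Zhang2014.kolyvaginIndex W p q : ℕ∞))) ∧
      signPart W K τ ((p ^ k : ℕ) : ℤ) (if !eb s.1 then 1 else -1)
          (selmerF W ((p ^ k : ℕ) : ℤ) 𝒯 (placesDividing K s.1)).selmerGroup = ⊥ ∧
      IsAddCyclic (signPart W K τ ((p ^ k : ℕ) : ℤ) (if eb s.1 then 1 else -1)
          (selmerF W ((p ^ k : ℕ) : ℤ) 𝒯 (placesDividing K s.1)).selmerGroup) ∧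
      Nat.card (signPart W K τ ((p ^ k : ℕ) : ℤ) (if eb s.1 then 1 else -1)
          (selmerF W ((p ^ k : ℕ) : ℤ) 𝒯 (placesDividing K s.1)).selmerGroup) = p ^ k ∧
      (if divOrd (D s) p < Zhang2014.levelIndex W p s.1 then divOrd (D s) p else (⊤ : ℕ∞)) ≤
        (if divOrd (D ⟨c, hc⟩) p < Zhang2014.levelIndex W p c then divOrd (D ⟨c, hc⟩) p else ⊤) := by
  have hp : p.Prime := Fact.out
  have hc0 : c ≠ 0 := hc.1.ne_zero
  -- ### `u := m(c)` as a natural number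
  set mcc : ℕ∞ := (if divOrd (D ⟨c, hc⟩) p < Zhang2014.levelIndex W p c then divOrd (D ⟨c, hc⟩) p
    else (⊤ : ℕ∞)) with hmcc_def
  have hmcc_ne : mcc ≠ ⊤ := ne_top_of_lt h0
  set u : ℕ := mcc.toNat with hu
  have hmcu : mcc = (u : ℕ∞) := (ENat.coe_toNat hmcc_ne).symm
  have hku : ((k + u : ℕ) : ℕ∞) = (k : ℕ∞) + mcc := by rw [hmcu]; push_cast; rfl
  have hcidx : ∀ q ∈ c.primeFactors, k + u ≤ Zhang2014.kolyvaginIndex W p q :=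
    Zhang2014.natCast_le_levelIndex_iff.mp (hku ▸ hMc)
  -- ### the pool of primes `P` and the place `λ(ℓ)`
  let P : Type := {ℓ : ℕ // Zhang2014.IsKolyvaginPrime (W.conductorNorm ℤ) W K p ℓ ∧
    k + u ≤ Zhang2014.kolyvaginIndex W p ℓ ∧ ¬ ℓ ∣ c ∧ ℓ ≠ 2}
  have hPprime : ∀ ℓ : P, (ℓ : ℕ).Prime := fun ℓ ↦ ℓ.2.1.1
  have hPk : ∀ ℓ : P, k ≤ Zhang2014.kolyvaginIndex W p ℓ := fun ℓ ↦ le_trans (Nat.le_add_right k u) ℓ.2.2.1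
  let lam : P → HeightOneSpectrum (𝓞 K) := fun ℓ ↦
    ⟨Ideal.span {((ℓ : ℕ) : 𝓞 K)}, ℓ.2.1.2.2.2.2.1, by
      rw [Ne, Ideal.span_singleton_eq_bot]
      exact_mod_cast (hPprime ℓ).ne_zero⟩
  have hlam_mem : ∀ ℓ : P, ((ℓ : ℕ) : 𝓞 K) ∈ (lam ℓ).asIdeal := fun ℓ ↦ Ideal.mem_span_singleton_self _
  -- ### the conductors `c·∏ n` (an opaque function with its specification)
  obtain ⟨cond, hcond⟩ : ∃ cond : Finset P → ℕ, ∀ n, cond n = c * ∏ ℓ ∈ n, (ℓ : ℕ) :=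
    ⟨_, fun _ ↦ rfl⟩
  have hcond_empty : cond ∅ = c := by rw [hcond, Finset.prod_empty, mul_one]
  have hcond_insert : ∀ (n : Finset P) (ℓ : P), ℓ ∉ n → cond (insert ℓ n) = cond n * ℓ := by
    intro n ℓ hℓ
    rw [hcond, hcond, Finset.prod_insert hℓ]
    ring
  -- admissibility of every conductor of the walk
  have hadm : ∀ n : Finset P, (Squarefree (cond n) ∧
      ∀ q ∈ (cond n).primeFactors, Zhang2014.IsKolyvaginPrime (W.conductorNorm ℤ) W K p q ∧
        k ≤ Zhang2014.kolyvaginIndex W p q) ∧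
      (∀ q ∈ (cond n).primeFactors, k + u ≤ Zhang2014.kolyvaginIndex W p q) ∧
      (∀ ℓ : P, ℓ ∉ n → ¬ (ℓ : ℕ) ∣ cond n) := by
    intro n
    obtain ⟨hsq, hfac, hnd⟩ := Walk.squarefree_mul_prod_facts (fun ℓ : P ↦ (ℓ : ℕ))
      Subtype.val_injective hPprime hc.1 (fun ℓ ↦ ℓ.2.2.2.1) n
    rw [hcond]
    refine ⟨⟨hsq, fun q hq ↦ ?_⟩, fun q hq ↦ ?_, hnd⟩
    · rw [hfac, Finset.mem_union, Finset.mem_image] at hq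
      rcases hq with hq | ⟨ℓ, -, rfl⟩
      · exact ⟨(hc.2 q hq).1, le_trans (Nat.le_add_right k u) (hcidx q hq)⟩
      · exact ⟨ℓ.2.1, hPk ℓ⟩
    · rw [hfac, Finset.mem_union, Finset.mem_image] at hq
      rcases hq with hq | ⟨ℓ, -, rfl⟩
      · exact hcidx q hq
      · exact ℓ.2.2.1
  -- the admissible conductor of `n`, as a point of the data subtype
  let sadm : Finset P → {m : ℕ // Squarefree m ∧ ∀ q ∈ m.primeFactors,
      Zhang2014.IsKolyvaginPrime (W.conductorNorm ℤ) W K p q ∧ k ≤ Zhang2014.kolyvaginIndex W p q} :=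
    fun n ↦ ⟨cond n, (hadm n).1⟩
  have hsadm_empty : sadm ∅ = ⟨c, hc⟩ := Subtype.ext hcond_empty
  have hsadm_insert : ∀ (n : Finset P) (ℓ : P), ℓ ∉ n → (sadm (insert ℓ n)).1 = (sadm n).1 * ℓ :=
    fun n ℓ hℓ ↦ hcond_insert n ℓ hℓ
  have hcond0 : ∀ n : Finset P, cond n ≠ 0 := fun n ↦ (hadm n).1.1.ne_zero
  have hMn : ∀ n : Finset P, (k : ℕ∞) + mcc ≤ Zhang2014.levelIndex W p (cond n) := fun n ↦ by
    rw [← hku]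
    exact Zhang2014.natCast_le_levelIndex_iff.mpr (hadm n).2.1
  -- places: `λ ∉ placesDividing (cond n)` for `ℓ ∉ n`, and the insertion rule
  have hlam_not : ∀ (n : Finset P) (ℓ : P), ℓ ∉ n → lam ℓ ∉ placesDividing K (cond n) :=
    fun n ℓ hℓ ↦ Walk.not_mem_placesDividing_of_not_dvd (hPprime ℓ) (hlam_mem ℓ) ((hadm n).2.2 ℓ hℓ)
  have hplaces_insert : ∀ (n : Finset P) (ℓ : P), ℓ ∉ n →
      placesDividing K (cond (insert ℓ n)) = insert (lam ℓ) (placesDividing K (cond n)) := by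
    intro n ℓ hℓ
    rw [hcond_insert n ℓ hℓ]
    exact Walk.placesDividing_mul_eq_insert (hcond0 n) (hPprime ℓ) ℓ.2.1.2.2.2.2.1 (hlam_mem ℓ)
  -- admissibility «ℓ above every prime factor of the conductor» implies freshness
  have hAdmP : ∀ (n : Finset P) (ℓ : P), (∀ q ∈ (cond n).primeFactors, q < (ℓ : ℕ)) → ℓ ∉ n := by
    intro n ℓ hlt hmem
    have hfac : (ℓ : ℕ) ∈ (cond n).primeFactors := by
      obtain ⟨_, hfac, _⟩ := Walk.squarefree_mul_prod_facts (fun ℓ : P ↦ (ℓ : ℕ))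
        Subtype.val_injective hPprime hc.1 (fun ℓ ↦ ℓ.2.2.2.1) n
      rw [hcond n, hfac, Finset.mem_union]
      exact Or.inr (Finset.mem_image_of_mem _ hmem)
    exact lt_irrefl _ (hlt _ hfac)
  -- every conductor of the walk is a multiple of `c`
  have hcdvd : ∀ n : Finset P, c ∣ (sadm n).1 := fun n ↦ by
    show c ∣ cond n; rw [hcond]; exact Dvd.intro _ rfl
  -- finiteness of the relaxed Selmer modules (Kummer structure)
  have hfin := Walk.hfin_of_kummer (K := K) W hp k 𝒯
  -- ### the abstract walk, instantiated
  have key := Section6.exists_coreVertex_adm (P := P) (k := k) hp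
    (loc := fun ℓ ↦ galoisCohomology.localization
      ((W.baseChange K).torsionGaloisModule ((p ^ k : ℕ) : ℤ)) (Sum.inr (lam ℓ)) 1)
    (Hf := fun ℓ _ ↦ (W.baseChange K).kummerSelmerStructure ((p ^ k : ℕ) : ℤ) (Sum.inr (lam ℓ)))
    (Htr := fun ℓ _ ↦ 𝒯 (Sum.inr (lam ℓ)))
    ?hdisj
    (Gs := fun b ↦ signPart W K τ ((p ^ k : ℕ) : ℤ) (if b then 1 else -1) ⊤)
    (Sel := fun n b ↦ signPart W K τ ((p ^ k : ℕ) : ℤ) (if b then 1 else -1)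
      (selmerF W ((p ^ k : ℕ) : ℤ) 𝒯 (placesDividing K (cond n))).selmerGroup)
    (Rel := fun n ℓ b ↦ signPart W K τ ((p ^ k : ℕ) : ℤ) (if b then 1 else -1)
      ((selmerF W ((p ^ k : ℕ) : ℤ) 𝒯 (placesDividing K (cond n))).relaxedAt {lam ℓ}).selmerGroup)
    ?hSelGs (Adm := fun n ℓ ↦ ∀ q ∈ (cond n).primeFactors, q < (ℓ : ℕ)) hAdmP ?hfin ?hSel ?hSelT ?hPT
    (e := fun n ↦ eb (cond n)) ?he ?h61
    (M := fun n ↦ Zhang2014.levelIndex W p (cond n))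
    (mdiv := fun n ↦ divOrd (D (sadm n)) p)
    (mc := fun n ↦ if divOrd (D (sadm n)) p < Zhang2014.levelIndex W p (cond n)
      then divOrd (D (sadm n)) p else ⊤)
    ?hm ?hM
    (κ := fun n ↦ ((D (sadm n)).kolyvaginClass hp k :
      galoisCohomology ((W.baseChange K).torsionGaloisModule ((p ^ k : ℕ) : ℤ)) 1))
    (κt := fun n ↦ if h : (if divOrd (D (sadm n)) p < Zhang2014.levelIndex W p (cond n)
        then divOrd (D (sadm n)) p else (⊤ : ℕ∞)) + (k : ℕ∞) ≤ Zhang2014.levelIndex W p (cond n)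
      then Classical.choose (hκt (sadm n) (hcdvd n) h) else 0)
    ?hκt ?hordκ ?h47 ?h0
  · -- read the conclusion at the core vertex `n`
    obtain ⟨n, hcore, hcard, hcyc, hmn⟩ := key
    refine ⟨sadm n, hcdvd n, ?_, hcore, hcyc, hcard, ?_⟩
    · intro q hq
      change q ∈ (cond n).primeFactors at hq
      obtain ⟨_, hfac, _⟩ := Walk.squarefree_mul_prod_facts (fun ℓ : P ↦ (ℓ : ℕ))
        Subtype.val_injective hPprime hc.1 (fun ℓ ↦ ℓ.2.2.2.1) n
      rw [hcond n, hfac, Finset.mem_union, Finset.mem_image] at hq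
      rcases hq with hq | ⟨ℓ, -, rfl⟩
      · exact Or.inl hq
      · right
        rw [← hku]
        exact_mod_cast ℓ.2.2.1
    · rwa [hsadm_empty, hcond_empty] at hmn
  case hdisj =>
    intro ℓ b
    exact hdisj ℓ ℓ.2.1 (hPk ℓ) ℓ.2.2.2.1 (lam ℓ) (hlam_mem ℓ)
  case hSelGs =>
    intro n b
    exact Walk.signPart_le_signPart_top W K τ _ _ _
  case hfin =>
    intro n ℓ b _
    haveI := hfin (cond n) (lam ℓ)
    exact Finite.of_injective _ (AddSubgroup.inclusion_injective (inf_le_left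
      (a := ((selmerF W ((p ^ k : ℕ) : ℤ) 𝒯 (placesDividing K (cond n))).relaxedAt {lam ℓ}).selmerGroup)
      (b := (conjActH1 W K τ ((p ^ k : ℕ) : ℤ) - (if b then (1 : ℤ) else -1) •
        AddMonoidHom.id _).ker)))
  case hSel =>
    intro n ℓ b hA
    have hℓ := hAdmP n ℓ hA
    show signPart W K τ _ _ (selmerF W _ 𝒯 (placesDividing K (cond n))).selmerGroup = _
    rw [← Walk.signPart_inf_right]
    congr 1
    exact Walk.selmerGroup_transverseAt_eq_relaxedAt_inf _ 𝒯 (hlam_not n ℓ hℓ)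
  case hSelT =>
    intro n ℓ b hA
    have hℓ := hAdmP n ℓ hA
    show signPart W K τ _ _ (selmerF W _ 𝒯 (placesDividing K (cond (insert ℓ n)))).selmerGroup = _
    rw [hplaces_insert n ℓ hℓ, ← Walk.signPart_inf_right]
    congr 1
    exact Walk.selmerGroup_transverseAt_insert _ 𝒯 _ (lam ℓ)
  case hPT =>
    intro n ℓ b hA
    exact hPT (sadm n) ℓ ℓ.2.1 (hPk ℓ) ((hadm n).2.2 ℓ (hAdmP n ℓ hA)) hA (hcdvd n) (lam ℓ) (hlam_mem ℓ)
      b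
  case he =>
    intro n ℓ hA
    have hℓ := hAdmP n ℓ hA
    rw [hcond_insert n ℓ hℓ]
    exact heb (cond n) ℓ (hPprime ℓ) ((hadm n).2.2 ℓ hℓ)
  case h61 =>
    intro b x y hx hy hy0 n
    rw [Walk.mem_signPart_top_iff] at hx hy
    have hes : ((if b then (1 : ℤ) else -1) = 1 ∨ (if b then (1 : ℤ) else -1) = -1) := by
      cases b <;> simp
    have hy' : conjAct W τ ((p ^ k : ℕ) : ℤ) y = (-(if b then (1 : ℤ) else -1)) • y := by
      rw [hy]; cases b <;> simp
    obtain ⟨ℓ₀, hbℓ₀, hZ, hidx, hord⟩ :=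
      exists_kolyvaginPrime_addOrderOf_localization_eq_shift_of_classX9_of_heegner W K hK hH p hX9 hHp τ hτ hk u hes x
        y hx hy' hy0 (max (cond n) 2)
    have hbℓ : cond n < ℓ₀ := lt_of_le_of_lt (le_max_left _ _) hbℓ₀
    have hℓ2 : ℓ₀ ≠ 2 := (lt_of_le_of_lt (le_max_right _ _) hbℓ₀).ne'
    have hcle : c ≤ cond n := by
      rw [hcond]
      exact Nat.le_mul_of_pos_right _ (Finset.prod_pos fun ℓ _ ↦ (hPprime ℓ).pos)
    have hℓc : ¬ ℓ₀ ∣ c := fun h ↦ by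
      have := Nat.le_of_dvd (Nat.pos_of_ne_zero hc0) h
      omega
    refine ⟨⟨ℓ₀, hZ, hidx, hℓc, hℓ2⟩, fun q hq ↦ ?_, hord (lam ⟨ℓ₀, hZ, hidx, hℓc, hℓ2⟩) (hlam_mem _)⟩
    exact lt_of_le_of_lt (Nat.le_of_mem_primeFactors hq) hbℓ
  case hm =>
    intro n h
    rw [if_pos h]
  case hM =>
    intro n
    rw [hsadm_empty, hcond_empty]
    exact hMn n
  case hκt =>
    intro n h
    simp only [dif_pos h]
    exact Classical.choose_spec (hκt (sadm n) (hcdvd n) h)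
  case hordκ =>
    intro n j hj hdvd
    exact hordκ (sadm n) j hj hdvd
  case h47 =>
    intro n ℓ hA
    have hℓ := hAdmP n ℓ hA
    exact h47 (sadm n) (sadm (insert ℓ n)) ℓ (hPprime ℓ) ℓ.2.2.2.2 ((hadm n).2.2 ℓ hℓ) (hsadm_insert n ℓ hℓ) hA
      (hcdvd n) (lam ℓ) (hlam_mem ℓ)
  case h0 =>
    rw [hsadm_empty, hcond_empty]
    exact h0

end Summit.BirchSwinnertonDyer.Rank1Residual.JET.Split

end
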